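import Summits.QuantumFields.BalabanUV.Beta.SymBorderedHessianBlind
import Summits.QuantumFields.BalabanUV.Beta.SymSliceProjectorFixed
import Summits.QuantumFields.BalabanUV.Beta.RelInvBorderedHessian

/-!
# `BalabanUV.Beta.RelInvSymBorderedHessian` — binder row D1, JSB12SYM-SPINE v1.1 (Σ3) step K2 part e: THE FOUR RULES
# `RelInv (coDressKSymAt ρ_c N KInv) (bhK N) (symEc N)` — the symmetrised co-dressed one-step resolvent is the relative inverse of the undressed
# bordered Hessian on the symmetrised slice (chart (II), centred root), and the `j = 0` instance for `KInvStep Lc 0`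

Pattern `RelInvBorderedHessian` §3–4 verbatim with `symEc` for `axEc`, `coDressKSymAt (ctr (d+1) N)` for `coDressKBmAt (toSite r)`, `piKSymBm(C)` for
`piKBm(C)`: rules 1–2 = K1b-4 `comp_symEc_coDressKSymAt` ∕ `comp_coDressKSymAt_symEc` (`KInv_inr_off`, `KInv_inr_right_off`); rules 3–4 = blindness
(K2-d) + residual identity (`comp_bhK_KInv`, `comp_KInv_bhK` BY NAME) + residual dressing (K2-c) + `symEc ∘ Π̂ᵀ_sym,C = symEc` (K2-a).
CHART (RULING R-D1-g25-4): chart (II) — the FIXED κ = 0 slice at the centred root; the slice-exchange row hSX is a SEPARATE binder and is NOT here.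
HONEST FRAMING (cell contract, verbatim): «discharging `BetaPertH` makes Bałaban's UV stability UNCONDITIONAL — a real constructive-QFT
result; it is NOT the continuum limit and NOT the Clay problem.»  THIS MODULE DISCHARGES NOTHING of `BetaPertH` ∕ row D1: [folklore] assembly of
OUR objects' identities; it is the `j = 0` relative-inverse socket of the symmetrised letter-level wiring (K3 ∕ `RowD1JointEndSym` come next);
JsB12Sym 0∕4 binders.  0 sorry, 0 `def … : Prop`, nothing cited.  NOT D1, NOT BetaPertH, NOT continuum, NOT Clay.
HONEST DEPENDENCY (verbatim): «continuum YM on T⁴ ⇐ BetaPertH ∧ nine spine estimates (0/9 proved); BetaPertH ⇐ (D1) ∧ (D4) ∧ CAP+tail;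
G-an2-4 gates asym, D1 and NE2/3/4.»  ABSOLUTE RULE (cell, verbatim): «No internally-minted statement may enter as a cited fact. Every
hypothesis is either kernel-proved in this package or a verbatim quotation of a PUBLISHED theorem with page reference.»
Unit `b2b-balaban-beta-an2` gen 25 (row-D1 owner), 2026-08-21.
-/

namespace Summit.QuantumFields.BalabanUV.Beta.RelInvSymBorderedHessian

noncomputable section

open Finset
open scoped BigOperators Nat
open Literature.Probability.LatticeModels (TorusSite Torus.proj Torus.proj_apply)
open Literature.MathematicalPhysics.QuantumFieldTheory
open Literature.MathematicalPhysics.QuantumFieldTheory.Balaban1983to89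
open Literature.MathematicalPhysics.QuantumFieldTheory.Balaban1983to89.Beta
open ExpKernelCalculus (MKer comp)
open AffineAveraging (Form0 Form1 Site box toSite)
open AveragingContoursRooted (ctr ctrOff ctrOff_mem_box)
open OneStepResolventKernel (Fib KInv KInv_inr_off)
open OneStepKernelFamily (KInvStep)
open Summit.QuantumFields.BalabanUV.Beta.TameKernelCalculus
open Summit.QuantumFields.BalabanUV.Beta.ChartConjugationRelative (RelInv spr_comp)
open Summit.QuantumFields.BalabanUV.Beta.AxialDressingRooted (KInv_inr_right_off)
open Summit.QuantumFields.BalabanUV.Beta.BorderedHessian (bhK spr_bhK resid comp_bhK_KInv comp_KInv_bhK spr_KInv KInvStep_zero_eq)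
open Summit.QuantumFields.BalabanUV.Beta.SymmetrisedDressingKernel
open Summit.QuantumFields.BalabanUV.Beta.SymSliceProjectorKernel (symEc)
open Summit.QuantumFields.BalabanUV.Beta.SymSliceProjectorSpread (spr_symEc)
open Summit.QuantumFields.BalabanUV.Beta.SymSliceProjectorRules (piKSymBmC comp_symEc_coDressKSymAt comp_coDressKSymAt_symEc)
open Summit.QuantumFields.BalabanUV.Beta.SymSliceProjectorFixed (comp_symEc_piKSymBmC comp_trK_piKSymBmC_symEc)
open Summit.QuantumFields.BalabanUV.Beta.SymBorderedHessianResidualDressing (comp_resid_piKSymBm comp_trK_piKSymBm_trK_resid)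
open Summit.QuantumFields.BalabanUV.Beta.SymBorderedHessianBlind (comp_bhK_trK_piKSymBm comp_piKSymBm_bhK)

variable {d : ℕ} {N : ℕ} [NeZero N]

/-! ## §1 Rules 3–4 for the symmetrised co-dressed one-step resolvent against the undressed bordered Hessian -/

omit [NeZero N] in
/-- [folklore] `ctr = toSite ctrOff`. -/
theorem ctr_eq : ctr (d + 1) N = toSite (ctrOff (d + 1) N) := rfl

/-- [folklore] `bhK N ∘ G = Π̂ᵀ_sym,C` for `G := Π̂_sym KInv Π̂ᵀ_sym`: blindness, residual, and the dressing of the residual. -/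
theorem comp_bhK_coDressKSymAt_KInv :
    comp (bhK N) (coDressKSymAt (ctr (d + 1) N) N (KInv (N := N))) = piKSymBmC (d := d) (ctr (d + 1) N) N := by
  have hN : 1 ≤ N := Nat.one_le_iff_ne_zero.mpr (NeZero.ne N)
  have hr : ctrOff (d + 1) N ∈ box (d + 1) N := ctrOff_mem_box hN
  have sM : Spr (bhK (d := d) N) := spr_bhK hN
  have sP : Spr (piKSymBm (d := d) (ctr (d + 1) N) N) := by rw [ctr_eq]; exact spr_piKSymBm hN hr
  have sPt : Spr (trK (piKSymBm (d := d) (ctr (d + 1) N) N)) := sP.trK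
  have sK : Spr (KInv (N := N) (d := d)) := spr_KInv
  have hb : comp (bhK N) (trK (piKSymBm (d := d) (ctr (d + 1) N) N)) = bhK N := by rw [ctr_eq]; exact comp_bhK_trK_piKSymBm hr
  have hrd : comp (resid N) (piKSymBm (d := d) (ctr (d + 1) N) N) = piKSymBmC (ctr (d + 1) N) N := by
    rw [ctr_eq]; exact comp_resid_piKSymBm N hr
  rw [coDressKSymAt_eq, comp_assoc_tame sM.tame (spr_comp sPt sK).tame sP.tame, comp_assoc_tame sM.tame sPt.tame sK.tame, hb, comp_bhK_KInv, hrd]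

/-- [folklore] **RULE 4**: `(symEc ∘ bhK N) ∘ G = symEc`. -/
theorem rule4_KInv_sym :
    comp (comp (symEc N) (bhK N)) (coDressKSymAt (ctr (d + 1) N) N (KInv (N := N))) = symEc (d := d) N := by
  have hN : 1 ≤ N := Nat.one_le_iff_ne_zero.mpr (NeZero.ne N)
  have hr : ctrOff (d + 1) N ∈ box (d + 1) N := ctrOff_mem_box hN
  have sE : Spr (symEc (d := d) N) := spr_symEc hN
  have sM : Spr (bhK (d := d) N) := spr_bhK hN
  have sG : Spr (coDressKSymAt (ctr (d + 1) N) N (KInv (N := N) (d := d))) := by rw [ctr_eq]; exact spr_coDressKSymAt hN hr spr_KInv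
  rw [← comp_assoc_tame sE.tame sM.tame sG.tame, comp_bhK_coDressKSymAt_KInv, comp_symEc_piKSymBmC hN]

/-- [folklore] `G ∘ bhK N = Π̂_sym,C`: the transposed chain (left blindness, left residual, transposed dressing of the residual). -/
theorem comp_coDressKSymAt_KInv_bhK :
    comp (coDressKSymAt (ctr (d + 1) N) N (KInv (N := N))) (bhK N) = trK (piKSymBmC (d := d) (ctr (d + 1) N) N) := by
  have hN : 1 ≤ N := Nat.one_le_iff_ne_zero.mpr (NeZero.ne N)
  have hr : ctrOff (d + 1) N ∈ box (d + 1) N := ctrOff_mem_box hN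
  have sM : Spr (bhK (d := d) N) := spr_bhK hN
  have sP : Spr (piKSymBm (d := d) (ctr (d + 1) N) N) := by rw [ctr_eq]; exact spr_piKSymBm hN hr
  have sPt : Spr (trK (piKSymBm (d := d) (ctr (d + 1) N) N)) := sP.trK
  have sK : Spr (KInv (N := N) (d := d)) := spr_KInv
  have hb : comp (piKSymBm (d := d) (ctr (d + 1) N) N) (bhK N) = bhK N := by rw [ctr_eq]; exact comp_piKSymBm_bhK hr
  have hrd : comp (trK (piKSymBm (d := d) (ctr (d + 1) N) N)) (trK (resid N)) = trK (piKSymBmC (ctr (d + 1) N) N) := by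
    rw [ctr_eq]; exact comp_trK_piKSymBm_trK_resid N hr
  rw [coDressKSymAt_eq, ← comp_assoc_tame (spr_comp sPt sK).tame sP.tame sM.tame, hb, ← comp_assoc_tame sPt.tame sK.tame sM.tame, comp_KInv_bhK,
    hrd]

/-- [folklore] **RULE 3**: `(G ∘ bhK N) ∘ symEc = symEc`. -/
theorem rule3_KInv_sym :
    comp (comp (coDressKSymAt (ctr (d + 1) N) N (KInv (N := N))) (bhK N)) (symEc N) = symEc (d := d) N := by
  have hN : 1 ≤ N := Nat.one_le_iff_ne_zero.mpr (NeZero.ne N)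
  rw [comp_coDressKSymAt_KInv_bhK, comp_trK_piKSymBmC_symEc hN]

/-- [folklore] **THE RELATIVE INVERSE AT THE ONE-STEP LEVEL, SYMMETRISED**: `G := Π̂_sym (KInv N) Π̂ᵀ_sym` and the undressed bordered Hessian
`bhK N` satisfy all four rules of `RelInv G (bhK N) (symEc N)` (centred root, chart (II), `N ≥ 1`). -/
theorem relInv_coDressKSymAt_KInv :
    RelInv (coDressKSymAt (ctr (d + 1) N) N (KInv (N := N) (d := d))) (bhK N) (symEc N) := by
  have hN : 1 ≤ N := Nat.one_le_iff_ne_zero.mpr (NeZero.ne N)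
  have h1 : comp (symEc N) (coDressKSymAt (ctr (d + 1) N) N (KInv (N := N) (d := d))) = coDressKSymAt (ctr (d + 1) N) N (KInv (N := N)) :=
    comp_symEc_coDressKSymAt hN (spr_KInv (N := N) (d := d)) (fun x hx z m b => KInv_inr_off hx m b z)
  have h2 : comp (coDressKSymAt (ctr (d + 1) N) N (KInv (N := N) (d := d))) (symEc N) = coDressKSymAt (ctr (d + 1) N) N (KInv (N := N)) :=
    comp_coDressKSymAt_symEc hN (spr_KInv (N := N) (d := d)) (fun z hz x a m => KInv_inr_right_off hz x a m)
  exact ⟨h1, h2, rule3_KInv_sym, rule4_KInv_sym⟩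

/-! ## §2 The `j = 0` instance of the step family -/

omit [NeZero N] in
/-- [folklore] **`RelInv G₀ (bhK Lc) (symEc Lc)`** for `G₀ := coDressKSymAt ρ_c Lc (KInvStep Lc 0)` (`KInvStep Lc 0 = KInv Lc`). -/
theorem relInv_coDressKSymAt_KInvStep_zero {Lc : ℕ} [NeZero Lc] :
    RelInv (coDressKSymAt (ctr (d + 1) Lc) Lc (KInvStep (d := d) Lc 0)) (bhK Lc) (symEc Lc) := by
  rw [KInvStep_zero_eq]; exact relInv_coDressKSymAt_KInv

end

end Summit.QuantumFields.BalabanUV.Beta.RelInvSymBorderedHessian
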